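import Summits.BirchSwinnertonDyer.BirchSwinnertonDyer.Theses.EisensteinDepletionAtTwo
import Literature.NumberTheory.EllipticCurves.IsogenyFrobeniusTraceHoldsProofs
import Literature.NumberTheory.EllipticCurves.EichlerShimuraConstruction
import Literature.NumberTheory.EllipticCurves.ShimuraSubgroupHeckeCongruence
import Summits.BirchSwinnertonDyer.BirchSwinnertonDyer.Theorems.EisensteinDepletionAtTwoStarOptBNSFStubLevelDetect
import Summits.BirchSwinnertonDyer.BirchSwinnertonDyer.Theorems.EisensteinDepletionAtTwoStarOptBNSFStubIsogenyFactor
import Summits.BirchSwinnertonDyer.BirchSwinnertonDyer.Theorems.EisensteinDepletionAtTwoStarOptBNSFStubOddIsoArch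
import Summits.BirchSwinnertonDyer.BirchSwinnertonDyer.Theorems.EisensteinDepletionAtTwoStarOptBNSFStubTwoPowerWalk
import Summits.BirchSwinnertonDyer.BirchSwinnertonDyer.Theorems.EisensteinDepletionAtTwoStarOptBNSFStubOddIsoTwoAdic
import Summits.BirchSwinnertonDyer.BirchSwinnertonDyer.Theorems.EisensteinDepletionAtTwoStarOptBTwoTorsionOfIsogenous
import Summits.BirchSwinnertonDyer.BirchSwinnertonDyer.Theorems.EisensteinDepletionAtTwoStarOptBNSFTwoAdicDictionary
import Summits.BirchSwinnertonDyer.BirchSwinnertonDyer.Theorems.ByReductionTypeAtTwoOrdIsogenyRescale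
import Summits.BirchSwinnertonDyer.BirchSwinnertonDyer.Theorems.EisensteinDepletionAtTwoStarOptBNSFOddShimuraCover
import HarnessLib

/-!
# Crux `StarOptBNSF` (item stmt-BirchSwinnertonDyer-27047, route `EisensteinDepletionAtTwo`): the CLOSED part of line `nsf`
# as TREE THEOREMS — the unconditional REGIME TRANSPORT, the parity count, and the by-name reductions
# `StarOptBNSF ⇐ P-E₀` and `StarOptBNSF ⇐ Stevens-at-2(E₁) ∧ X₁-optimal existence`

Lead bsd-rank2-star-p1 GEN 8.  Line `nsf` (planner p2 GEN 31–33, HOME/p2/g33/line-nsf.lean v1–v8) proved, inside its skeleton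
file, that every bookkeeping stub is closed: v1's monolithic `stub_regimeTransport` became a theorem once `stub_isogenyFactor`
(eng-2 GEN 17, p628690), `stub_oddIsoUnique` / `stub_oddIsoArch` / `stub_oddIsoTwoAdic` (lead GEN 7, p630848 / p632363) and
`stub_twoPowerWalk` (eng-2 GEN 17, p631534) landed.  A skeleton file is not importable; this file puts that content in the TREE
so that the crux's open residue is BY NAME a single implication:

* `regimeTransport` — in a habitat class (`W` globally minimal, good ordinary at 2, unique rational 2-torsion point of Greenberg
  type A xor B) every globally minimal member `W₀` WITHOUT a formal rational 2-torsion point has a rational 2-torsion point that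
  is ODD and ÉTALE (planner p2 GEN 32/33's kernel-checked composition `regimeTransport_of`, verbatim over the tree names).
* `halfLattice_not_all` — no rank-2 lattice lies in `ℤλ + 2Λ` (p2's parity count, used by the v1–v7 shadow form).
* `starOptBNSF_of_x0OptimalEtaleOrd` — `StarOptBNSF` from P-E₀ in its ORDINARY form «an `X₀(N)`-lattice-optimal globally minimal
  `W₀`, good ordinary at 2, at an odd level with a traceless prime has no rational 2-torsion abscissa with `v₂ < 0`» (the binder
  `IsOrdinaryAt W₀ 2` is what the crux supplies through `W ~ W₀`); `starOptBNSF_of_x0OptimalEtale` — from v8's registered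
  research stub P-E₀ verbatim (`stub_x0OptimalEtaleNSF`).
* `x0OptimalEtaleOrd_of_stevensAtTwoX1` and **`starOptBNSF_of_stevensAtTwoX1`** — from «Stevens' conjecture at 2 for the
  `X₁(N)`-optimal curve» (E1NF form, STEVENS-AT-TWO.md Prop. 1) plus the PRINT existence of that curve with Néron lattice
  `c₁Λ₁(f)` (tree named fact `exists_optimal_gamma1ParametrizationData`, here in lattice binders), through the ODD Shimura cover
  (`…Theorems.DepletionAtTwo.ShimuraCover.not_exists_ramified_of_gamma1Optimal`, p635403).

All hypotheses are explicit binders (no named-fact `def`s are introduced); the two research/print statements are exactly the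
stubs of the v9 skeleton candidate (HOME/p1g8/line-nsf-v9.lean, evidence #44 on 27047).
HONEST FRAMING: reductions of an OPEN crux; `StarOptBNSF` (27047) / `E1M_NSF` (27021) / BSD are NOT proved here; nothing reads an
analytic rank.

References: R. Greenberg, LNM 1716 (1999), §5 [GreenbergLNM1716]; G. Stevens, Invent. Math. 98 (1989), §2 [Stevens1989];
V. Vatsal, JIMJ 4 (2005), Thm. 1.10, Rem. 1.8 [Vatsal2005]; S. Ling, J. Oesterlé, Astérisque 196–197 (1991), Thm. 6
[LingOesterle1991]; B. Conrad, S. Edixhoven, W. Stein, Doc. Math. 8 (2003), §6.1 [ConradEdixhovenStein2003].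
-/

set_option linter.dupNamespace false
set_option autoImplicit false

noncomputable section

open Literature.NumberTheory.EllipticCurves
open Literature.NumberTheory.EllipticCurves.Greenberg1999
open Literature.NumberTheory.EllipticCurves.ModularForms

namespace Summit.BirchSwinnertonDyer.BirchSwinnertonDyer.Theorems.DepletionAtTwo.NsfReduction

/-! ### The regime transport (v1's `stub_regimeTransport`, unconditional) -/

/-- **REGIME TRANSPORT** (line `nsf` v1 stub 3, now unconditional; composition = planner p2 GEN 32/33's `regimeTransport_of`
over the five landed split stubs).  In a habitat class — `W` globally minimal, good ordinary at `2`, with a UNIQUE rational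
2-torsion abscissa `x` of Greenberg type A xor B — every globally minimal `W₀` isogenous to `W` WITHOUT a formal rational
2-torsion point has a rational 2-torsion abscissa that is ODD and NOT ramified at 2.  `W₀` is good ordinary at 2
(`isOrdinaryAt_of_isIsogenous`), has a rational 2-torsion point (`stub_twoTorsionOfIsogenous`) and, having no formal one, a unique
one (`hasUniqueRationalTwoTorsionX_of_forall_not_ramified_rat`); factor `W → V ← W₀` into 2-power and odd parts
(`stub_isogenyFactor`); the odd isogeny `W₀ → V` transports uniqueness and both type bits (`stub_oddIsoUnique`, `stub_oddIsoTwoAdic`,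
`stub_oddIsoArch`), so `V` has no formal point; the 2-power walk (`stub_twoPowerWalk`) gives an odd étale point of `V`, which is the
unique one; transport «odd» back. [cite: GreenbergLNM1716, §5 p. 168] [cite: SilvermanAEC2009, III.4.12 and III.6.1] -/
theorem regimeTransport :
    ∀ (W : WeierstrassCurve ℚ) [W.IsElliptic] [W.IsGloballyMinimal] (x : ℚ),
      IsOrdinaryAt W 2 → HasUniqueRationalTwoTorsionX W x →
      ((TwoTorsionRamifiedAtTwo x ∧ ¬ TwoTorsionOdd W x) ∨
        (TwoTorsionOdd W x ∧ ¬ TwoTorsionRamifiedAtTwo x)) →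
      ∀ (W₀ : WeierstrassCurve ℚ) [W₀.IsElliptic] [W₀.IsGloballyMinimal],
        WeierstrassCurve.IsIsogenous W W₀ →
        (¬ ∃ x₀ : ℚ, HasRationalTwoTorsionX W₀ x₀ ∧ TwoTorsionRamifiedAtTwo x₀) →
        ∃ x₀ : ℚ, HasRationalTwoTorsionX W₀ x₀ ∧ TwoTorsionOdd W₀ x₀ ∧ ¬ TwoTorsionRamifiedAtTwo x₀ := by
  intro W _ _ x hord hux hAB W₀ _ _ hiso hno
  have hF := Summit.BirchSwinnertonDyer.BirchSwinnertonDyer.Theorems.EisensteinDepletionAtTwoStarOptBNSFStubIsogenyFactor.stub_isogenyFactor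
  have hWalk := Summit.BirchSwinnertonDyer.BirchSwinnertonDyer.Theorems.DepletionAtTwo.Walk.stub_twoPowerWalk
  have hU := Summit.BirchSwinnertonDyer.BirchSwinnertonDyer.Theorems.DepletionAtTwo.NsfStubs.stub_oddIsoUnique
  have hR := Summit.BirchSwinnertonDyer.BirchSwinnertonDyer.Theorems.DepletionAtTwo.NsfStubs.stub_oddIsoArch
  have hT := Summit.BirchSwinnertonDyer.BirchSwinnertonDyer.Theorems.DepletionAtTwo.NsfStubs.stub_oddIsoTwoAdic
  have hord₀ : IsOrdinaryAt W₀ 2 :=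
    Summit.BirchSwinnertonDyer.BirchSwinnertonDyer.Theorems.IsogenyMuShift.isOrdinaryAt_of_isIsogenous hiso hord
  obtain ⟨x₀, hx₀⟩ :=
    Summit.BirchSwinnertonDyer.BirchSwinnertonDyer.Theorems.DepletionAtTwo.stub_twoTorsionOfIsogenous W W₀ hiso ⟨x, hux.1⟩
  have hno' : ∀ z : ℚ, HasRationalTwoTorsionX W₀ z → ¬ TwoTorsionRamifiedAtTwo z :=
    fun z hz hr ↦ hno ⟨z, hz, hr⟩
  have hu₀ : HasUniqueRationalTwoTorsionX W₀ x₀ :=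
    Summit.BirchSwinnertonDyer.BirchSwinnertonDyer.Theorems.DepletionAtTwo.TwoAdic.hasUniqueRationalTwoTorsionX_of_forall_not_ramified_rat
      W₀ hord₀.1 hno' hx₀
  obtain ⟨V, hVell, hVmin, φ₁, ψ, hk, hodd⟩ := hF W W₀ hiso
  obtain ⟨xV, huV⟩ := hU W₀ V ψ hodd x₀ hu₀
  have hramIff := hT W₀ V ψ hodd hord₀ x₀ xV hu₀ huV
  have hoddIff := hR W₀ V ψ hodd x₀ xV hu₀ huV
  have hnoV : ¬ ∃ z : ℚ, HasRationalTwoTorsionX V z ∧ TwoTorsionRamifiedAtTwo z := by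
    rintro ⟨z, hz, hr⟩
    have hzx : z = xV := huV.2 z hz
    rw [hzx] at hr
    exact hno' x₀ hx₀ (hramIff.mpr hr)
  obtain ⟨x₁, hx₁, hodd₁, -⟩ := hWalk W x hord hux hAB V φ₁ hk hnoV
  have hx₁V : x₁ = xV := huV.2 x₁ hx₁
  rw [hx₁V] at hodd₁
  exact ⟨x₀, hx₀, hoddIff.mpr hodd₁, hno' x₀ hx₀⟩

/-! ### The index-2 parity count -/

/-- **No rank-2 lattice lies in a parity sublattice.**  For a period pair `L₀` and `λ ∈ Λ₀`, NOT every lattice vector lies in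
`ℤλ + 2Λ₀` (reduce mod `2Λ₀ ≅ (ℤ/2)²`: the image of `ℤλ + 2Λ₀` has order ≤ 2); coordinates in the basis `ω₁, ω₂` and a parity
count (planner p2 GEN 31, line `nsf`). [folklore] -/
theorem halfLattice_not_all (L₀ : PeriodPair) {lam : ℂ} (hlam : lam ∈ L₀.lattice) :
    ¬ ∀ z ∈ L₀.lattice, ∃ k : ℤ, ∃ w ∈ L₀.lattice, z = (k : ℂ) * lam + 2 * w := by
  intro hall
  obtain ⟨a, b, hab⟩ := PeriodPair.mem_lattice.mp hlam
  obtain ⟨k₁, w₁, hw₁, h₁⟩ := hall _ L₀.ω₁_mem_lattice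
  obtain ⟨k₂, w₂, hw₂, h₂⟩ := hall _ L₀.ω₂_mem_lattice
  obtain ⟨c₁, d₁, hcd₁⟩ := PeriodPair.mem_lattice.mp hw₁
  obtain ⟨c₂, d₂, hcd₂⟩ := PeriodPair.mem_lattice.mp hw₂
  have e₁ := LinearIndependent.pair_iff.mp L₀.indep ((k₁ * a + 2 * c₁ - 1 : ℤ) : ℝ)
    ((k₁ * b + 2 * d₁ : ℤ) : ℝ) (by
      rw [Complex.real_smul, Complex.real_smul]
      push_cast
      linear_combination (k₁ : ℂ) * hab + 2 * hcd₁ - h₁)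
  have e₂ := LinearIndependent.pair_iff.mp L₀.indep ((k₂ * a + 2 * c₂ : ℤ) : ℝ)
    ((k₂ * b + 2 * d₂ - 1 : ℤ) : ℝ) (by
      rw [Complex.real_smul, Complex.real_smul]
      push_cast
      linear_combination (k₂ : ℂ) * hab + 2 * hcd₂ - h₂)
  obtain ⟨e₁a, e₁b⟩ := e₁
  obtain ⟨-, e₂b⟩ := e₂
  have h1a : k₁ * a + 2 * c₁ - 1 = 0 := by exact_mod_cast e₁a
  have h1b : k₁ * b + 2 * d₁ = 0 := by exact_mod_cast e₁b
  have h2b : k₂ * b + 2 * d₂ - 1 = 0 := by exact_mod_cast e₂b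
  have hk2b : Odd (k₂ * b) := ⟨-d₂, by linarith⟩
  have hb : Odd b := (Int.odd_mul.mp hk2b).2
  have hk1a : Odd (k₁ * a) := ⟨-c₁, by linarith⟩
  have hk1 : Odd k₁ := (Int.odd_mul.mp hk1a).1
  have hk1b : Even (k₁ * b) := ⟨-d₁, by linarith⟩
  exact (Int.not_even_iff_odd.mpr (Int.odd_mul.mpr ⟨hk1, hb⟩)) hk1b

/-! ### `StarOptBNSF` from P-E₀ -/

/-- **`StarOptBNSF ⇐ P-E₀ (ordinary form).**  If every `X₀(N)`-lattice-optimal globally minimal `W₀` (Néron lattice `qΛ_f`), good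
ordinary at `2`, whose newform has odd level with a traceless prime, has NO rational 2-torsion abscissa ramified at `2`, then the
crux `StarOptBNSF` holds: `2 ∤ N` and the traceless prime come from `stub_levelDetect` (`p² ∣ N_W`, good ordinary at 2), `W ~ W₀`
from Faltings (`IsNewformOf.isIsogenous`), ordinarity transports, and `regimeTransport` finishes.  (Planner p2 GEN 33's
`StarOptBNSF_of`, v8, with the ordinarity binder made explicit.) [cite: LingOesterle1991, Thm. 6] [cite: GreenbergLNM1716, §5] -/
theorem starOptBNSF_of_x0OptimalEtaleOrd
    (hP : ∀ (W₀ : WeierstrassCurve ℚ) [W₀.IsElliptic] [W₀.IsGloballyMinimal]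
      ⦃N : ℕ⦄ [NeZero N] (f : CuspForm (CongruenceSubgroup.Gamma0 N) 2), IsNewformOf W₀ f →
      ¬ 2 ∣ N → (∃ p : ℕ, p.Prime ∧ p ∣ N ∧ cuspCoeff f p = 0) → IsOrdinaryAt W₀ 2 →
      ∀ (L₀ : PeriodPair), IsNeronLatticeOf (W₀.baseChange ℂ) L₀ →
      ∀ (q : ℚ), q ≠ 0 → (∀ z ∈ periodLattice f, (q : ℂ) * z ∈ L₀.lattice) →
      (∀ z ∈ L₀.lattice, ∃ w ∈ periodLattice f, z = (q : ℂ) * w) →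
      ∀ (x₀ : ℚ), HasRationalTwoTorsionX W₀ x₀ → ¬ TwoTorsionRamifiedAtTwo x₀) :
    Summit.BirchSwinnertonDyer.BirchSwinnertonDyer.Theses.EisensteinDepletionAtTwo.StarOptBNSF := by
  intro W _ _ x hord hux htype hN15 hnsf N _ f hW W₀ _ _ hW₀ L₀ hL₀ q hq hin hout
  have hL := Summit.BirchSwinnertonDyer.BirchSwinnertonDyer.Theorems.EisensteinDepletionAtTwoStarOptBNSFStubLevelDetect.stub_levelDetect
  have hiso : WeierstrassCurve.IsIsogenous W W₀ :=
    IsNewformOf.isIsogenous WeierstrassCurve.isIsogenous_iff_frobeniusTrace_eq_holds hW hW₀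
  have hord₀ : IsOrdinaryAt W₀ 2 :=
    Summit.BirchSwinnertonDyer.BirchSwinnertonDyer.Theorems.IsogenyMuShift.isOrdinaryAt_of_isIsogenous hiso hord
  refine regimeTransport W x hord hux htype W₀ hiso ?_
  rintro ⟨x₀, hx₀, hram⟩
  obtain ⟨h2N, hlev⟩ := hL W f hW
  have hodd : ¬ 2 ∣ N := h2N hord
  obtain ⟨p, hp, hp2⟩ : ∃ p : ℕ, p.Prime ∧ p ^ 2 ∣ W.conductorNorm ℤ := by
    by_contra hcon
    push Not at hcon
    exact hnsf (Nat.squarefree_iff_prime_squarefree.mpr fun p hp hpp ↦ hcon p hp (by simpa [sq] using hpp))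
  obtain ⟨hpN, hap⟩ := hlev p hp hp2
  exact hP W₀ f hW₀ hodd ⟨p, hp, hpN, hap⟩ hord₀ L₀ hL₀ q hq hin hout x₀ hx₀ hram

/-- **`StarOptBNSF ⇐ P-E₀`** with P-E₀ = line `nsf` v8's registered research stub `stub_x0OptimalEtaleNSF` VERBATIM (no ordinarity
binder). [cite: LingOesterle1991, Thm. 6] -/
theorem starOptBNSF_of_x0OptimalEtale
    (hP : ∀ (W₀ : WeierstrassCurve ℚ) [W₀.IsElliptic] [W₀.IsGloballyMinimal]
      ⦃N : ℕ⦄ [NeZero N] (f : CuspForm (CongruenceSubgroup.Gamma0 N) 2), IsNewformOf W₀ f →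
      ¬ 2 ∣ N → (∃ p : ℕ, p.Prime ∧ p ∣ N ∧ cuspCoeff f p = 0) →
      ∀ (L₀ : PeriodPair), IsNeronLatticeOf (W₀.baseChange ℂ) L₀ →
      ∀ (q : ℚ), q ≠ 0 → (∀ z ∈ periodLattice f, (q : ℂ) * z ∈ L₀.lattice) →
      (∀ z ∈ L₀.lattice, ∃ w ∈ periodLattice f, z = (q : ℂ) * w) →
      ∀ (x₀ : ℚ), HasRationalTwoTorsionX W₀ x₀ → ¬ TwoTorsionRamifiedAtTwo x₀) :
    Summit.BirchSwinnertonDyer.BirchSwinnertonDyer.Theses.EisensteinDepletionAtTwo.StarOptBNSF :=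
  starOptBNSF_of_x0OptimalEtaleOrd fun W₀ _ _ _ _ f hW₀ hodd hp _ L₀ hL₀ q hq hin hout x₀ hx₀ ↦
    hP W₀ f hW₀ hodd hp L₀ hL₀ q hq hin hout x₀ hx₀

/-! ### P-E₀ and `StarOptBNSF` from Stevens' conjecture at 2 for the `X₁(N)`-optimal curve -/

/-- **P-E₀ (ordinary form) ⇐ Stevens-at-2(`E₁`) ∧ existence of `E₁`.**  Hypotheses: (`hS`) for every globally minimal `W₁`, good
ordinary at `2`, with newform `f` of odd level carrying a traceless prime and Néron lattice `c₁·Λ₁(f)` (`c₁ ∈ ℚˣ`; Stevens'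
`X₁(N)`-optimal curve), no rational 2-torsion abscissa is ramified at `2` — Stevens' conjecture (1989) at `ℓ = 2` in E1NF form
(STEVENS-AT-TWO.md Prop. 1; the `p = 2` case left open by Vatsal 2005 Thm 1.10); (`hX`) every elliptic `W₀` with newform `f` has
such a `W₁` in its class — the tree's named fact `exists_optimal_gamma1ParametrizationData` read in lattice binders
(Conrad–Edixhoven–Stein 2003 §6.1; Stevens 1989 §2).  Conclusion: P-E₀ for `W₀` good ordinary at 2.  Proof: `W₀ ~ W₁` (Faltings) so
`W₁` is ordinary; the ODD Shimura cover (`ShimuraCover.not_exists_ramified_of_gamma1Optimal`: Ling–Oesterlé at the traceless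
prime, degree of the lattice-inclusion isogeny, 2-adic inertia transport) carries «no formal rational 2-torsion» from `W₁` to `W₀`.
[cite: Stevens1989, §2] [cite: Vatsal2005, Rem. 1.8 and Thm. 1.10] [cite: ConradEdixhovenStein2003, §6.1 Lemma 6.1.6] -/
theorem x0OptimalEtaleOrd_of_stevensAtTwoX1
    (hS : ∀ (W₁ : WeierstrassCurve ℚ) [W₁.IsElliptic] [W₁.IsGloballyMinimal]
      ⦃N : ℕ⦄ [NeZero N] (f : CuspForm (CongruenceSubgroup.Gamma0 N) 2), IsNewformOf W₁ f →
      ¬ 2 ∣ N → (∃ p : ℕ, p.Prime ∧ p ∣ N ∧ cuspCoeff f p = 0) → IsOrdinaryAt W₁ 2 →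
      ∀ (L₁ : PeriodPair), IsNeronLatticeOf (W₁.baseChange ℂ) L₁ →
      ∀ (c₁ : ℚ), c₁ ≠ 0 → (∀ z ∈ periodLatticeGamma1 f, (c₁ : ℂ) * z ∈ L₁.lattice) →
      (∀ z ∈ L₁.lattice, ∃ w ∈ periodLatticeGamma1 f, z = (c₁ : ℂ) * w) →
      ∀ (x₁ : ℚ), HasRationalTwoTorsionX W₁ x₁ → ¬ TwoTorsionRamifiedAtTwo x₁)
    (hX : ∀ (W₀ : WeierstrassCurve ℚ) [W₀.IsElliptic]
      ⦃N : ℕ⦄ [NeZero N] (f : CuspForm (CongruenceSubgroup.Gamma0 N) 2), IsNewformOf W₀ f →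
      ∃ (W₁ : WeierstrassCurve ℚ) (_ : W₁.IsElliptic) (_ : W₁.IsGloballyMinimal) (L₁ : PeriodPair) (c₁ : ℚ),
        IsNewformOf W₁ f ∧ IsNeronLatticeOf (W₁.baseChange ℂ) L₁ ∧ c₁ ≠ 0 ∧
          (∀ z ∈ periodLatticeGamma1 f, (c₁ : ℂ) * z ∈ L₁.lattice) ∧
          (∀ z ∈ L₁.lattice, ∃ w ∈ periodLatticeGamma1 f, z = (c₁ : ℂ) * w)) :
    ∀ (W₀ : WeierstrassCurve ℚ) [W₀.IsElliptic] [W₀.IsGloballyMinimal]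
      ⦃N : ℕ⦄ [NeZero N] (f : CuspForm (CongruenceSubgroup.Gamma0 N) 2), IsNewformOf W₀ f →
      ¬ 2 ∣ N → (∃ p : ℕ, p.Prime ∧ p ∣ N ∧ cuspCoeff f p = 0) → IsOrdinaryAt W₀ 2 →
      ∀ (L₀ : PeriodPair), IsNeronLatticeOf (W₀.baseChange ℂ) L₀ →
      ∀ (q : ℚ), q ≠ 0 → (∀ z ∈ periodLattice f, (q : ℂ) * z ∈ L₀.lattice) →
      (∀ z ∈ L₀.lattice, ∃ w ∈ periodLattice f, z = (q : ℂ) * w) →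
      ∀ (x₀ : ℚ), HasRationalTwoTorsionX W₀ x₀ → ¬ TwoTorsionRamifiedAtTwo x₀ := by
  intro W₀ _ _ N _ f hW₀ hodd hp hord₀ L₀ hL₀ q hq hin hout x₀ hx₀ hram
  obtain ⟨p, hp, hpN, hap⟩ := hp
  have hp2 : p ≠ 2 := by
    rintro rfl
    exact hodd hpN
  obtain ⟨W₁, _i₁, _i₂, L₁, c₁, hW₁, hL₁, hc₁, hin₁, hout₁⟩ := hX W₀ f hW₀
  have hiso : WeierstrassCurve.IsIsogenous W₀ W₁ :=
    IsNewformOf.isIsogenous WeierstrassCurve.isIsogenous_iff_frobeniusTrace_eq_holds hW₀ hW₁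
  have hord₁ : IsOrdinaryAt W₁ 2 :=
    Summit.BirchSwinnertonDyer.BirchSwinnertonDyer.Theorems.IsogenyMuShift.isOrdinaryAt_of_isIsogenous hiso hord₀
  have hno₁ : ¬ ∃ x₁ : ℚ, HasRationalTwoTorsionX W₁ x₁ ∧ TwoTorsionRamifiedAtTwo x₁ := by
    rintro ⟨x₁, hx₁, hram₁⟩
    exact hS W₁ f hW₁ hodd ⟨p, hp, hpN, hap⟩ hord₁ L₁ hL₁ c₁ hc₁ hin₁ hout₁ x₁ hx₁ hram₁
  exact Summit.BirchSwinnertonDyer.BirchSwinnertonDyer.Theorems.DepletionAtTwo.ShimuraCover.not_exists_ramified_of_gamma1Optimal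
    W₀ W₁ hord₀ f hW₀.1 hp hp2 hpN hap hL₀ hL₁ hq hc₁ hin hout hin₁ hout₁ hno₁ ⟨x₀, hx₀, hram⟩

/-- **`StarOptBNSF ⇐ Stevens-at-2(E₁) ∧ existence of E₁`** — the crux `StarOptBNSF` (stmt-BirchSwinnertonDyer-27047) BY NAME from the
two `J₁(N)`-side statements (the v9 skeleton's stubs `stub_stevensAtTwoX1`, `stub_x1Optimal`); everything else is a tree theorem.
[cite: Stevens1989, §2] [cite: LingOesterle1991, Thm. 6] [cite: GreenbergLNM1716, §5 p. 168] -/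
theorem starOptBNSF_of_stevensAtTwoX1
    (hS : ∀ (W₁ : WeierstrassCurve ℚ) [W₁.IsElliptic] [W₁.IsGloballyMinimal]
      ⦃N : ℕ⦄ [NeZero N] (f : CuspForm (CongruenceSubgroup.Gamma0 N) 2), IsNewformOf W₁ f →
      ¬ 2 ∣ N → (∃ p : ℕ, p.Prime ∧ p ∣ N ∧ cuspCoeff f p = 0) → IsOrdinaryAt W₁ 2 →
      ∀ (L₁ : PeriodPair), IsNeronLatticeOf (W₁.baseChange ℂ) L₁ →
      ∀ (c₁ : ℚ), c₁ ≠ 0 → (∀ z ∈ periodLatticeGamma1 f, (c₁ : ℂ) * z ∈ L₁.lattice) →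
      (∀ z ∈ L₁.lattice, ∃ w ∈ periodLatticeGamma1 f, z = (c₁ : ℂ) * w) →
      ∀ (x₁ : ℚ), HasRationalTwoTorsionX W₁ x₁ → ¬ TwoTorsionRamifiedAtTwo x₁)
    (hX : ∀ (W₀ : WeierstrassCurve ℚ) [W₀.IsElliptic]
      ⦃N : ℕ⦄ [NeZero N] (f : CuspForm (CongruenceSubgroup.Gamma0 N) 2), IsNewformOf W₀ f →
      ∃ (W₁ : WeierstrassCurve ℚ) (_ : W₁.IsElliptic) (_ : W₁.IsGloballyMinimal) (L₁ : PeriodPair) (c₁ : ℚ),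
        IsNewformOf W₁ f ∧ IsNeronLatticeOf (W₁.baseChange ℂ) L₁ ∧ c₁ ≠ 0 ∧
          (∀ z ∈ periodLatticeGamma1 f, (c₁ : ℂ) * z ∈ L₁.lattice) ∧
          (∀ z ∈ L₁.lattice, ∃ w ∈ periodLatticeGamma1 f, z = (c₁ : ℂ) * w)) :
    Summit.BirchSwinnertonDyer.BirchSwinnertonDyer.Theses.EisensteinDepletionAtTwo.StarOptBNSF :=
  starOptBNSF_of_x0OptimalEtaleOrd (x0OptimalEtaleOrd_of_stevensAtTwoX1 hS hX)

end Summit.BirchSwinnertonDyer.BirchSwinnertonDyer.Theorems.DepletionAtTwo.NsfReduction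

end
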